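import Summits.RiemannHypothesis.RiemannHypothesis.Theorems.HandoffSemilocalOddBump
import Summits.RiemannHypothesis.RiemannHypothesis.Theorems.HandoffLoadCeiling
import HarnessLib

-- gen10 re-file of p374161 (bounced `dedup.landed`: the local `cap_pos` duplicated `HandoffLoadCeiling.cap_pos` — now imported and reused; nothing else changed).

/-!
# HANDOFF — the LOGARITHMIC FOOT of the new prime's capacity: an explicit-constant variant with the Cramér bump (cell rh-explicit, TRACK «HANDOFF», seat theory-2 gen6; companion of idea-3 PART G14 / prove-2 ATTEMPT-14)

HONEST FRAMING AND PRIORITY. Nothing here bears on the truth of RH. The statement «the Birman–Schwinger capacity of the new prime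
(`HandoffCapacity.bsCapacity`, file XII-h) has a LOGARITHMIC foot at its entrance, `ρ_q((log q)/2 + δ) ≳ w_q/(2 log(1/δ))`, so no power
law `c·δ^κ` and no right-derivative at `δ = 0`; section-level start exponents describe the IR channel only» is handoff-idea-3 gen14's
(HOME/handoff/IDEAS-finite-rank.md PART G14-3/G14-4, 2026-08-23T20:37Z), and its first kernel form is handoff-prove-2 gen6's ATTEMPT-14
chain (`HandoffTranslatedKernel`, `HandoffTranslatePair`, `HandoffCapacityUVFloor`: `uvFloor q δ = w_q/(2·weilGroundEnergy δ + w_q + 12δe^{3δ})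
≤ ρ_q`, the SHARPER constant — the tiny-window ground energy `ε₀(δ)` — with the difference-of-translates witness). THIS FILE is an
independent, later (theory-2 gen6, 23:24Z) variant of the same floor with an EXPLICIT constant and a different witness — gen2's odd two-layer
pair (`HandoffCapSharp`) rebuilt from prove-2's Cramér bump (`HandoffCramerBump`, `HandoffSemilocalOddBump`) — recorded for three small
additions: the `log(1/δ)` appears in the statement with a `δ`-free constant (no `ε₀(δ)`; prove-2's floor becomes this shape by gen2's
`re_weilQuadratic_cramerBump_le`), the `{p < q}`-form energy of the witness is bounded RH-free WITHOUT the window input, and the lag-range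
bookkeeping is explicit. Every reading below is idea-3's G14-4, cited, not this seat's.
* §1–§2 the odd Cramér pair `g = f − f(−·)`, `f = cramerBump δ ((log q)/2)` (radius `δ`, centred AT the entrance point, so that the
  `log q`-translate of the left lobe is exactly the right lobe): `g ∈ C((log q)/2 + δ)`, `‖g‖₂² = 2‖f‖₂²`, `k_g(±log q) = −‖f‖₂²`, hence
  **`contribution_q(g) = cap(q)·‖g‖₂²`**, `cap(q) = (log q)/√q = w_q/2` (the cap of `HandoffEdgeLayer`, saturated, as in `HandoffCapSharp` and
  prove-2's `contribution_translatePair`; idea-3 G14-1 / prove-2 ATTEMPT-14 §1: the gain of the pair `θ(·−c) − θ(−·−c)` is `+w_q‖θ‖²` for EVEN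
  profiles — the Cramér bump is even).
* §3 **ENERGY** (RH-free): for a prime `q ≥ 3` and `0 < δ` with `e^{2δ} ≤ 1 + 1/q` (≈ the first `1/(2q)` of the window, cf. idea-3's
  `δ < 1/(2(q+1))`; it contains every certified wall offset of the cell — DATA): `Re Q_{S_q}(g) ≤ (log(1/δ) + cramerEnergyConst + 3)·‖g‖₂²`
  (`S_q = {p < q}`; prove-2's witness-side bound for an antisymmetrised lobe + the bump ceiling; on this range the lag interval
  `[q e^{−2δ}, q e^{2δ}]` of the cross kernel holds no `S_q`-smooth prime power except possibly `q + 1 = 2^k`), and, on the window of the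
  consecutive primes `q < q′`, `Re Q(g) ≤ (log(1/δ) + cramerEnergyConst + 3 + cap(q))·‖g‖₂²`.
* §4 **THE FOOT, explicit-constant form** (RH-free inequality): `cap(q)·Re Q(g) ≤ (log(1/δ) + cramerEnergyConst + 3 + cap(q))·contribution_q(g)`,
  `contribution_q(g) > 0`; under the window input `0 < ε(b)` of XII-h this reads `ρ_q((log q)/2 + δ) ≥ cap(q)/(log(1/δ) + cramerEnergyConst + 3 + cap(q))`
  — weaker than prove-2's `uvFloor` (whose `2ε₀(δ) ≤ 2 log(1/δ) + 2·cramerEnergyConst`), same logarithmic shape. `cramerEnergyConst = 3 + 4e + L_φ/π`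
  carries the log-moment `L_φ` of Mathlib's UNSPECIFIED bump (`someContDiffBumpBase` is `Nonempty.some`): the constant is a definite but not
  determinable real; the `log(1/δ)` is exact. The link to `bsCapacity` waits for XII-h's hub olean (build backlog of 2026-08-23).

References: E. Bombieri, Rend. Mat. Acc. Lincei (9) 11 (2000) 183–233, Thm 2 / §4 Lemma 2 / §12 (12.3)–(12.5) (`Bombieri2000Weil`); A. Connes,
C. Consani, Enseign. Math. 69 (2023) 93–148, §2.2–§2.3 (`ConnesConsani2023`); M. Sh. Birman, Mat. Sb. 55 (1961) / J. Schwinger, PNAS 47 (1961), as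
read in R. Frank, A. Laptev, T. Weidl, *Schrödinger Operators: Eigenvalues and Lieb–Thirring Inequalities* (CUP 2023) §1.2.8 (coupling-constant
principle). Priority for the statement and its reading: this cell's handoff-idea-3 PART G14 and handoff-prove-2 ATTEMPT-14 (above); not in print
as far as the cell has searched.
-/

set_option linter.dupNamespace false  -- the mandated namespace repeats `RiemannHypothesis`

noncomputable section

open Complex Filter Set MeasureTheory Literature.NumberTheory.LFunctions
  Literature.NumberTheory.LFunctions.WeilContinuous
open Summit.RiemannHypothesis.RiemannHypothesis.Theorems.Handoff
open scoped Real Topology ComplexConjugate ArithmeticFunction.vonMangoldt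

namespace Summit.RiemannHypothesis.RiemannHypothesis.Theorems.HandoffCapacityFoot

variable {q q' : ℕ} {L δ : ℝ}

/-! ## §1 The Cramér lobe centred at `L/2`: pointwise facts -/

/-- Off `[L/2 − δ, L/2 + δ]` the lobe `cramerBump δ (L/2)` vanishes. [folklore] -/
theorem lobe_eq_zero (hδ : 0 < δ) {u : ℝ} (hu : u < L / 2 - δ ∨ L / 2 + δ < u) : cramerBump δ (L / 2) u = 0 := by
  refine cramerBump_eq_zero hδ fun h ↦ ?_
  rcases hu with hu | hu <;> [exact absurd h.1 (not_le.2 hu); exact absurd h.2 (not_le.2 hu)]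

/-- The lobe is symmetric about its centre: `f(L − u) = f(u)` (`φ₀` is even). [folklore] -/
theorem lobe_sub_eq (L δ u : ℝ) : cramerBump δ (L / 2) (L - u) = cramerBump δ (L / 2) u := by
  unfold cramerBump
  rw [show (L - u - L / 2) / δ = -((u - L / 2) / δ) by ring, TwoBump.moll_zero_neg]

/-- The reflected lobe is the lobe centred at `−L/2`: `f(−u) = cramerBump δ (−L/2) u`. [folklore] -/
theorem lobe_neg_eq (L δ u : ℝ) : cramerBump δ (L / 2) (-u) = cramerBump δ (-(L / 2)) u := by
  unfold cramerBump
  rw [show (-u - L / 2) / δ = -((u - -(L / 2)) / δ) by ring, TwoBump.moll_zero_neg]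

/-- If the lobe is non-zero at `u` then `u ∈ [L/2 − δ, L/2 + δ]`. [folklore] -/
theorem mem_of_lobe_ne_zero (hδ : 0 < δ) {u : ℝ} (hu : cramerBump δ (L / 2) u ≠ 0) :
    L / 2 - δ ≤ u ∧ u ≤ L / 2 + δ := by
  by_contra h
  rw [not_and_or, not_le, not_le] at h
  exact hu (lobe_eq_zero hδ h)

/-- The two lobes are disjoint (`2δ < L`): `f(u)·f(−u) = 0`, in the form «one of them vanishes». [folklore] -/
theorem lobe_eq_zero_or_lobe_neg_eq_zero (hδ : 0 < δ) (hL : 2 * δ < L) (u : ℝ) :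
    cramerBump δ (L / 2) u = 0 ∨ cramerBump δ (L / 2) (-u) = 0 := by
  by_cases h : cramerBump δ (L / 2) u = 0
  · exact Or.inl h
  · exact Or.inr (lobe_eq_zero hδ (Or.inl (by linarith [(mem_of_lobe_ne_zero hδ h).1])))

/-- The autocorrelation integrand of the ODD pair `g = f − f(−·)` at lag `L` is `−|f(u)|²` pointwise (`2δ < L`): only the right
lobe meets the `L`-translate of the left lobe, with opposite signs. [this track, HANDOFF-STATEMENT §A.4 (gen2, for Mathlib's bump)] -/
theorem oddPair_mul_conj_shift (hδ : 0 < δ) (hL : 2 * δ < L) (u : ℝ) :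
    (cramerBump δ (L / 2) u - cramerBump δ (L / 2) (-u)) *
        conj (cramerBump δ (L / 2) (u - L) - cramerBump δ (L / 2) (-(u - L))) =
      -((‖cramerBump δ (L / 2) u‖ ^ 2 : ℝ) : ℂ) := by
  set f := cramerBump δ (L / 2) with hf
  have hrefl : f (-(u - L)) = f u := by rw [hf, show -(u - L) = L - u by ring, lobe_sub_eq]
  rw [hrefl]
  by_cases hu : f u = 0
  · rw [hu]  -- then either `f(−u) = 0` too, or `u` is in the left lobe and `f(u − L) = 0`
    by_cases hu' : f (-u) = 0
    · rw [hu']; simp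
    · have hm := mem_of_lobe_ne_zero (L := L) hδ hu'
      have h1 : f (u - L) = 0 := lobe_eq_zero hδ (Or.inl (by linarith [hm.2]))
      rw [h1]; simp
  · have hm := mem_of_lobe_ne_zero (L := L) hδ hu
    have h1 : f (-u) = 0 := lobe_eq_zero hδ (Or.inl (by linarith [hm.1]))
    have h2 : f (u - L) = 0 := lobe_eq_zero hδ (Or.inl (by linarith [hm.2]))
    rw [h1, h2, sub_zero, zero_sub, map_neg, mul_neg, Complex.mul_conj, Complex.normSq_eq_norm_sq]

/-- Pointwise norm of either pair: `‖f(u) ± f(−u)‖² = ‖f(u)‖² + ‖f(−u)‖²` (disjoint lobes). [folklore] -/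
theorem norm_sq_pair (hδ : 0 < δ) (hL : 2 * δ < L) (u : ℝ) (σ : ℂ) (hσ : ‖σ‖ = 1) :
    ‖cramerBump δ (L / 2) u + σ * cramerBump δ (L / 2) (-u)‖ ^ 2 =
      ‖cramerBump δ (L / 2) u‖ ^ 2 + ‖cramerBump δ (L / 2) (-u)‖ ^ 2 := by
  rcases lobe_eq_zero_or_lobe_neg_eq_zero hδ hL u with h | h
  · rw [h, zero_add, norm_mul, hσ, one_mul]; simp
  · rw [h, mul_zero, add_zero]; simp

/-! ## §2 The pairs as Weil test functions: class, support, norm, autocorrelation at `±log q`, contribution -/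

/-- The odd pair is a Weil test function. [folklore] -/
theorem isWeilTest_oddPair (hδ : 0 < δ) (L : ℝ) :
    IsWeilTest fun x ↦ cramerBump δ (L / 2) x - cramerBump δ (L / 2) (-x) :=
  isWeilTest_sub_comp_neg (isWeilTest_cramerBump hδ _)

/-- Support of either pair: `⊆ [−(L/2 + δ), L/2 + δ]` (`0 < δ`, `2δ ≤ L`). [folklore] -/
theorem tsupport_pair_subset (hδ : 0 < δ) (hL : 2 * δ ≤ L) (σ : ℂ) :
    tsupport (fun x ↦ cramerBump δ (L / 2) x + σ * cramerBump δ (L / 2) (-x)) ⊆ Icc (-(L / 2 + δ)) (L / 2 + δ) := by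
  refine closure_minimal (fun x hx ↦ ?_) isClosed_Icc
  rw [Function.mem_support] at hx
  by_contra hxI
  rw [Set.mem_Icc, not_and_or, not_le, not_le] at hxI
  apply hx
  rcases hxI with h | h
  · rw [lobe_eq_zero hδ (Or.inl (by linarith)), lobe_eq_zero hδ (Or.inr (by linarith))]; simp
  · rw [lobe_eq_zero hδ (Or.inr (by linarith)), lobe_eq_zero hδ (Or.inl (by linarith))]; simp

/-- `‖f ± f(−·)‖₂² = 2‖f‖₂² = 2δ·‖φ₀‖₂²`. [folklore] -/
theorem integral_norm_sq_pair (hδ : 0 < δ) (hL : 2 * δ < L) (σ : ℂ) (hσ : ‖σ‖ = 1) :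
    ∫ u : ℝ, ‖cramerBump δ (L / 2) u + σ * cramerBump δ (L / 2) (-u)‖ ^ 2 =
      2 * ∫ u : ℝ, ‖cramerBump δ (L / 2) u‖ ^ 2 := by
  have e : (fun u : ℝ ↦ ‖cramerBump δ (L / 2) u + σ * cramerBump δ (L / 2) (-u)‖ ^ 2) =
      fun u : ℝ ↦ ‖cramerBump δ (L / 2) u‖ ^ 2 + ‖cramerBump δ (-(L / 2)) u‖ ^ 2 := by
    funext u; rw [norm_sq_pair hδ hL u σ hσ, lobe_neg_eq]
  rw [e, integral_add (isWeilTest_cramerBump hδ _).integrable_norm_sq (isWeilTest_cramerBump hδ _).integrable_norm_sq,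
    integral_norm_sq_cramerBump hδ (L / 2), integral_norm_sq_cramerBump hδ (-(L / 2))]
  ring

/-- `0 < ‖f ± f(−·)‖₂²`. [folklore] -/
theorem integral_norm_sq_pair_pos (hδ : 0 < δ) (hL : 2 * δ < L) (σ : ℂ) (hσ : ‖σ‖ = 1) :
    0 < ∫ u : ℝ, ‖cramerBump δ (L / 2) u + σ * cramerBump δ (L / 2) (-u)‖ ^ 2 := by
  rw [integral_norm_sq_pair hδ hL σ hσ, integral_norm_sq_cramerBump hδ (L / 2)]
  have := half_le_weilNorm2Sq_moll_zero; positivity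

/-- **Autocorrelation of the odd pair at lag `L`**: `k_g(L) = −‖f‖₂²`. [this track, HANDOFF-STATEMENT §A.4] -/
theorem weilConv_weilReflect_oddPair (hδ : 0 < δ) (hL : 2 * δ < L) :
    weilConv (fun x ↦ cramerBump δ (L / 2) x - cramerBump δ (L / 2) (-x))
        (weilReflect fun x ↦ cramerBump δ (L / 2) x - cramerBump δ (L / 2) (-x)) L =
      -((∫ u : ℝ, ‖cramerBump δ (L / 2) u‖ ^ 2 : ℝ) : ℂ) := by
  rw [weilConv_weilReflect_eq_integral]
  have e : (fun u : ℝ ↦ (cramerBump δ (L / 2) u - cramerBump δ (L / 2) (-u)) *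
        conj (cramerBump δ (L / 2) (u - L) - cramerBump δ (L / 2) (-(u - L)))) =
      fun u : ℝ ↦ -((‖cramerBump δ (L / 2) u‖ ^ 2 : ℝ) : ℂ) := by
    funext u; exact oddPair_mul_conj_shift hδ hL u
  rw [e, integral_neg, integral_complex_ofReal]

/-- **The odd pair saturates the cap**: `contribution_q(f − f(−·)) = cap(q)·‖f − f(−·)‖₂²` for the Cramér lobe of radius `δ` centred at
`(log q)/2`, `0 < 2δ < log q` — the prime `q` RESCUES this odd function by the full cap of `HandoffEdgeLayer.abs_contribution_le`.
[cite: ConnesConsani2023, §2.2–§2.3 (a prime's contribution on its window); sharpness: this track, HANDOFF-STATEMENT §A.4/§D.1, `HandoffCapSharp`] -/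
theorem contribution_oddPair (hδ : 0 < δ) (hL : 2 * δ < Real.log q) :
    contribution q (fun x ↦ cramerBump δ (Real.log q / 2) x - cramerBump δ (Real.log q / 2) (-x)) =
      Real.log q / Real.sqrt q *
        ∫ u : ℝ, ‖cramerBump δ (Real.log q / 2) u - cramerBump δ (Real.log q / 2) (-u)‖ ^ 2 := by
  set g : ℝ → ℂ := fun x ↦ cramerBump δ (Real.log q / 2) x - cramerBump δ (Real.log q / 2) (-x) with hg
  have hk : weilConv g (weilReflect g) (Real.log q) = -((∫ u : ℝ, ‖cramerBump δ (Real.log q / 2) u‖ ^ 2 : ℝ) : ℂ) :=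
    weilConv_weilReflect_oddPair hδ hL
  have hk' : weilConv g (weilReflect g) (-Real.log q) = -((∫ u : ℝ, ‖cramerBump δ (Real.log q / 2) u‖ ^ 2 : ℝ) : ℂ) := by
    rw [← conj_weilConv_weilReflect_neg g (-Real.log q), neg_neg, hk, map_neg, Complex.conj_ofReal]
  have hn : ∫ u : ℝ, ‖g u‖ ^ 2 = 2 * ∫ u : ℝ, ‖cramerBump δ (Real.log q / 2) u‖ ^ 2 := by
    simpa [hg, sub_eq_add_neg] using integral_norm_sq_pair (L := Real.log q) hδ hL (-1) (by simp)
  unfold contribution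
  rw [hk, hk', hn, ← Complex.ofReal_neg, ← Complex.ofReal_add, Complex.ofReal_re]
  ring

/-! ## §3 ENERGY of the odd pair on the first part of the window (RH-free) -/

/-- A bound for the archimedean cross constant: `archGapBound c′ ≤ 21/16` for `c′ ≥ 1/3` (`e^{c′} ≥ 4/3`, `e^{−4c′} ≤ 3/7`).
[folklore] -/
theorem archGapBound_le_of_third_le {c' : ℝ} (hc' : 1 / 3 ≤ c') : archGapBound c' ≤ 21 / 16 := by
  unfold archGapBound
  have h1 : (4 : ℝ) / 3 ≤ Real.exp c' := by linarith [Real.add_one_le_exp c']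
  have h2 : Real.exp (-(4 * c')) ≤ 3 / 7 := by
    have h3 : Real.exp (-(4 * c')) ≤ Real.exp (-(4 / 3)) := Real.exp_le_exp.2 (by linarith)
    have h4 : Real.exp (-(4 / 3 : ℝ)) ≤ 3 / 7 := by
      have h5 := Real.add_one_le_exp (4 / 3 : ℝ)
      have h6 : Real.exp (-(4 / 3 : ℝ)) * Real.exp (4 / 3) = 1 := by rw [← Real.exp_add]; norm_num
      have h7 : 0 < Real.exp (-(4 / 3 : ℝ)) := Real.exp_pos _
      nlinarith
    exact h3.trans h4
  have hden : (16 : ℝ) / 21 ≤ Real.exp c' * (1 - Real.exp (-(4 * c'))) := by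
    have h8 : (4 : ℝ) / 7 ≤ 1 - Real.exp (-(4 * c')) := by linarith
    calc (16 : ℝ) / 21 = 4 / 3 * (4 / 7) := by norm_num
      _ ≤ Real.exp c' * (1 - Real.exp (-(4 * c'))) := mul_le_mul h1 h8 (by norm_num) (Real.exp_pos _).le
  rw [div_le_iff₀ (lt_of_lt_of_le (by norm_num) hden)]
  nlinarith [hden]

/-- `Λ_{S_q}(q)/√q = 0`: the prime `q` is not `{p < q}`-smooth. [folklore] -/
theorem weilSemilocalCoeff_primesBelow_self (hq : q.Prime) : weilSemilocalCoeff (Nat.primesBelow q) q = 0 := by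
  unfold weilSemilocalCoeff
  rw [if_neg]
  intro hsub
  have hmem : q ∈ q.primeFactors := by rw [hq.primeFactors]; exact Finset.mem_singleton_self q
  exact lt_irrefl q (Nat.mem_primesBelow.1 (hsub hmem)).1

/-- For an odd prime `q`: `Λ_S(q+1)/√(q+1) ≤ (log 2)/√q` for every `S` (`q + 1` is even, so it is a prime power only as a power of `2`).
[folklore] -/
theorem weilSemilocalCoeff_succ_le (S : Finset ℕ) (hq : q.Prime) (h3 : 3 ≤ q) :
    weilSemilocalCoeff S (q + 1) ≤ Real.log 2 / Real.sqrt q := by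
  have hq0 : (0 : ℝ) < q := by exact_mod_cast hq.pos
  have hsq : 0 < Real.sqrt q := Real.sqrt_pos.2 hq0
  have hsq1 : Real.sqrt q ≤ Real.sqrt (((q + 1 : ℕ) : ℝ)) := Real.sqrt_le_sqrt (by push_cast; linarith)
  have h2 : 0 ≤ Real.log 2 := Real.log_nonneg (by norm_num)
  have heven : 2 ∣ q + 1 := by
    obtain ⟨k, hk⟩ := hq.odd_of_ne_two (by omega)
    exact ⟨k + 1, by omega⟩
  have hΛ : Λ (q + 1) ≤ Real.log 2 := by
    rw [ArithmeticFunction.vonMangoldt_apply]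
    split_ifs
    · rw [(Nat.minFac_eq_two_iff (q + 1)).2 heven]; push_cast; exact le_rfl
    · exact h2
  unfold weilSemilocalCoeff
  split_ifs
  · exact div_le_div₀ h2 hΛ hsq hsq1
  · positivity

/-- **The `S_q`-smooth atoms of the lag range are at most `(log 2)/√q`** on the first part of the window: for a prime `q ≥ 3` and
`e^{2δ} ≤ 1 + 1/q`, every integer `n` with `q e^{−2δ} ≤ n ≤ q e^{2δ}` is `q` or `q + 1`. [folklore] -/
theorem sum_weilSemilocalCoeff_lagRange_le (hq : q.Prime) (h3 : 3 ≤ q) (hδq : Real.exp (2 * δ) ≤ 1 + 1 / q) :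
    ∑ n ∈ Finset.Icc ⌈Real.exp (2 * (Real.log q / 2 - δ))⌉₊ ⌊Real.exp (2 * (Real.log q / 2 + δ))⌋₊,
        weilSemilocalCoeff (Nat.primesBelow q) n ≤ Real.log 2 / Real.sqrt q := by
  have hq0 : (0 : ℝ) < q := by exact_mod_cast hq.pos
  have hE : 0 < Real.exp (2 * δ) := Real.exp_pos _
  have e1 : Real.exp (2 * (Real.log q / 2 + δ)) = q * Real.exp (2 * δ) := by
    rw [show 2 * (Real.log q / 2 + δ) = Real.log q + 2 * δ by ring, Real.exp_add, Real.exp_log hq0]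
  have e2 : Real.exp (2 * (Real.log q / 2 - δ)) = q / Real.exp (2 * δ) := by
    rw [show 2 * (Real.log q / 2 - δ) = Real.log q + -(2 * δ) by ring, Real.exp_add, Real.exp_log hq0, Real.exp_neg,
      div_eq_mul_inv]
  have hB : ⌊Real.exp (2 * (Real.log q / 2 + δ))⌋₊ ≤ q + 1 := by
    refine Nat.floor_le_of_le ?_
    have : (q : ℝ) * Real.exp (2 * δ) ≤ q * (1 + 1 / q) := mul_le_mul_of_nonneg_left hδq hq0.le
    have e3 : (q : ℝ) * (1 + 1 / q) = q + 1 := by field_simp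
    rw [e1]; push_cast; linarith
  have hA : q ≤ ⌈Real.exp (2 * (Real.log q / 2 - δ))⌉₊ := by
    have hlow : (q : ℝ) - 1 < Real.exp (2 * (Real.log q / 2 - δ)) := by
      rw [e2, lt_div_iff₀ hE]
      have : ((q : ℝ) - 1) * Real.exp (2 * δ) ≤ (q - 1) * (1 + 1 / q) :=
        mul_le_mul_of_nonneg_left hδq (by linarith [show (3 : ℝ) ≤ q by exact_mod_cast h3])
      have e3 : ((q : ℝ) - 1) * (1 + 1 / q) = q - 1 / q := by field_simp; ring
      have h4 : 0 < 1 / (q : ℝ) := by positivity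
      linarith
    have h6 : (q : ℝ) < ⌈Real.exp (2 * (Real.log q / 2 - δ))⌉₊ + 1 := by linarith [hlow.trans_le (Nat.le_ceil _)]
    have h7 : q < ⌈Real.exp (2 * (Real.log q / 2 - δ))⌉₊ + 1 := by exact_mod_cast h6
    omega
  have hsub : Finset.Icc ⌈Real.exp (2 * (Real.log q / 2 - δ))⌉₊ ⌊Real.exp (2 * (Real.log q / 2 + δ))⌋₊ ⊆ {q, q + 1} := by
    intro n hn
    rw [Finset.mem_Icc] at hn
    rw [Finset.mem_insert, Finset.mem_singleton]; omega
  calc ∑ n ∈ Finset.Icc ⌈Real.exp (2 * (Real.log q / 2 - δ))⌉₊ ⌊Real.exp (2 * (Real.log q / 2 + δ))⌋₊,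
        weilSemilocalCoeff (Nat.primesBelow q) n
      ≤ ∑ n ∈ ({q, q + 1} : Finset ℕ), weilSemilocalCoeff (Nat.primesBelow q) n :=
        Finset.sum_le_sum_of_subset_of_nonneg hsub fun n _ _ ↦ weilSemilocalCoeff_nonneg _ n
    _ = weilSemilocalCoeff (Nat.primesBelow q) q + weilSemilocalCoeff (Nat.primesBelow q) (q + 1) :=
        Finset.sum_pair (by omega)
    _ ≤ Real.log 2 / Real.sqrt q := by
        rw [weilSemilocalCoeff_primesBelow_self hq, zero_add]
        exact weilSemilocalCoeff_succ_le _ hq h3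

/-- Elementary consequences of `q ≥ 3` and `e^{2δ} ≤ 1 + 1/q`: `δ ≤ 1/6` and `(log q)/2 > 1/2`. [folklore] -/
theorem delta_le_sixth (h3 : 3 ≤ q) (hδq : Real.exp (2 * δ) ≤ 1 + 1 / q) : δ ≤ 1 / 6 := by
  have h1 := Real.add_one_le_exp (2 * δ)
  have h2 : (1 : ℝ) / q ≤ 1 / 3 := by
    rw [div_le_div_iff₀ (by exact_mod_cast (by omega : 0 < q)) (by norm_num)]
    linarith [show (3 : ℝ) ≤ q by exact_mod_cast h3]
  linarith

/-- `(log q)/2 > 1/2` for `q ≥ 3` (`e < 3`). [folklore] -/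
theorem half_lt_log_half (h3 : 3 ≤ q) : 1 / 2 < Real.log q / 2 := by
  have hq0 : (0 : ℝ) < q := by exact_mod_cast (by omega : 0 < q)
  have h1 : (1 : ℝ) < Real.log q := by
    rw [Real.lt_log_iff_exp_lt hq0]
    linarith [Real.exp_one_lt_d9, show (3 : ℝ) ≤ q by exact_mod_cast h3]
  linarith

/-- **ENERGY OF THE ODD PAIR IN THE `{p < q}`-FORM (RH-free).** For a prime `q ≥ 3` and `0 < δ` with `e^{2δ} ≤ 1 + 1/q`, the odd
Cramér pair `g` of radius `δ` centred at `±(log q)/2` has `Re Q_{S_q}(g) ≤ (log(1/δ) + cramerEnergyConst + 3)·‖g‖₂²`: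
twice the bump's own ceiling `(log(1/δ) + cramerEnergyConst)‖f‖₂²` (prove-2), minus the (dropped, non-negative) polar mass, plus the
cross terms of the lag range `[q e^{−2δ}, q e^{2δ}]` — archimedean `≤ 16·(21/16)·δ·‖f‖₂²` and `S_q`-atoms `≤ 4(log 2)/√q·‖f‖₂²`
(only `q + 1 = 2^k` can occur). [cite: Bombieri2000Weil, Thm 2 / §12 (12.3)–(12.5); this track (prove-2 ATTEMPT-7 §5, ATTEMPT-12 §2; theory-2 gen6)] -/
theorem re_weilSemilocalQuadratic_oddPair_le (hq : q.Prime) (h3 : 3 ≤ q) (hδ : 0 < δ)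
    (hδq : Real.exp (2 * δ) ≤ 1 + 1 / q) :
    (weilSemilocalQuadratic (Nat.primesBelow q)
        (fun x ↦ cramerBump δ (Real.log q / 2) x - cramerBump δ (Real.log q / 2) (-x))).re ≤
      (Real.log (1 / δ) + cramerEnergyConst + 3) *
        ∫ u : ℝ, ‖cramerBump δ (Real.log q / 2) u - cramerBump δ (Real.log q / 2) (-u)‖ ^ 2 := by
  set L := Real.log q with hL
  set f := cramerBump δ (L / 2) with hf
  have hδ6 := delta_le_sixth h3 hδq
  have hL2 := half_lt_log_half h3
  have hδL : 2 * δ < L := by linarith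
  set c' : ℝ := L / 2 - δ with hc'
  set b : ℝ := L / 2 + δ with hb
  have hc'pos : 0 < c' := by linarith
  have hcb : c' ≤ b := by rw [hc', hb]; linarith
  have hfs : tsupport f ⊆ Icc c' b :=
    (tsupport_cramerBump_subset hδ (L / 2)).trans (Icc_subset_Icc (by rw [hc']) (by rw [hb]))
  -- prove-2's witness-side bound for the antisymmetrised lobe, and the bump ceiling
  have hU := re_weilSemilocalQuadratic_sub_comp_neg_le (Nat.primesBelow q) (isWeilTest_cramerBump hδ _) hc'pos hcb hfs
  have hE := re_weilSemilocalQuadratic_cramerBump_le (Nat.primesBelow q) hδ (by linarith) (L / 2)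
  set m := ∫ u : ℝ, ‖f u‖ ^ 2 with hm
  have hm0 : 0 ≤ m := integral_nonneg fun u ↦ by positivity
  have hP0 := Complex.normSq_nonneg (weilMellin (cramerBump δ (L / 2)) 0)
  have hP1 := Complex.normSq_nonneg (weilMellin (cramerBump δ (L / 2)) 1)
  have hM : archGapBound c' ≤ 21 / 16 := archGapBound_le_of_third_le (by rw [hc']; linarith)
  have hG := sum_weilSemilocalCoeff_lagRange_le hq h3 hδq
  set G := ∑ n ∈ Finset.Icc ⌈Real.exp (2 * (Real.log q / 2 - δ))⌉₊ ⌊Real.exp (2 * (Real.log q / 2 + δ))⌋₊,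
      weilSemilocalCoeff (Nat.primesBelow q) n with hGdef
  -- `(log 2)/√q ≤ 0.41` (`√q ≥ 1.7`), hence the lag-range constant `4·M(c′)·2δ + 2G ≤ 8·(21/16)/6 + 0.82 ≤ 3`
  have hl2 : Real.log 2 / Real.sqrt q ≤ 0.41 := by
    have hs : (1.7 : ℝ) ≤ Real.sqrt q := by
      rw [Real.le_sqrt (by norm_num) (by positivity)]; linarith [show (3 : ℝ) ≤ q by exact_mod_cast h3]
    rw [div_le_iff₀ (by linarith)]; nlinarith [Real.log_two_lt_d9]
  have hX : 4 * archGapBound c' * (b - c') + 2 * G ≤ 3 := by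
    rw [show b - c' = 2 * δ by rw [hb, hc']; ring]
    have : archGapBound c' * δ ≤ 21 / 16 * (1 / 6) := mul_le_mul hM hδ6 hδ.le (by norm_num)
    linarith [hG.trans hl2]
  have hn : ∫ u : ℝ, ‖f u - f (-u)‖ ^ 2 = 2 * m := by
    simpa [hf, hm, sub_eq_add_neg] using integral_norm_sq_pair (L := L) hδ hδL (-1) (by simp)
  rw [hn]
  have hX' := mul_le_mul_of_nonneg_right hX hm0
  calc (weilSemilocalQuadratic (Nat.primesBelow q) fun x ↦ f x - f (-x)).re
      ≤ 2 * (weilSemilocalQuadratic (Nat.primesBelow q) (cramerBump δ (L / 2))).re -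
          2 * (Complex.normSq (weilMellin (cramerBump δ (L / 2)) 0) + Complex.normSq (weilMellin (cramerBump δ (L / 2)) 1)) +
          2 * (4 * archGapBound c' * (b - c') + 2 * G) * m := hU
    _ ≤ (Real.log (1 / δ) + cramerEnergyConst + 3) * (2 * m) := by linarith [hE, hP0, hP1, hX']

/-- **ENERGY OF THE ODD PAIR IN WEIL'S FORM** on the window of the consecutive primes `q < q′` (`q ≥ 3`, `e^{2δ} ≤ 1 + 1/q`, so that
`b = (log q)/2 + δ ≤ (log q′)/2`): `Re Q(g) = contribution_q(g) + Re Q_{S_q}(g) ≤ (log(1/δ) + cramerEnergyConst + 3 + cap(q))·‖g‖₂²`.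
[cite: Bombieri2000Weil, Thm 2; this track] -/
theorem re_weilQuadratic_oddPair_le (h : ConsecutivePrimes q q') (h3 : 3 ≤ q) (hδ : 0 < δ)
    (hδq : Real.exp (2 * δ) ≤ 1 + 1 / q) :
    (weilQuadratic (fun x ↦ cramerBump δ (Real.log q / 2) x - cramerBump δ (Real.log q / 2) (-x))).re ≤
      (Real.log (1 / δ) + cramerEnergyConst + 3 + Real.log q / Real.sqrt q) *
        ∫ u : ℝ, ‖cramerBump δ (Real.log q / 2) u - cramerBump δ (Real.log q / 2) (-u)‖ ^ 2 := by
  have hq0 : (0 : ℝ) < q := by exact_mod_cast h.1.pos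
  have hδL : 2 * δ < Real.log q := by linarith [delta_le_sixth h3 hδq, half_lt_log_half h3]
  set g : ℝ → ℂ := fun x ↦ cramerBump δ (Real.log q / 2) x - cramerBump δ (Real.log q / 2) (-x) with hg
  -- the window: `(log q)/2 + δ ≤ (log q′)/2` since `q e^{2δ} ≤ q + 1 ≤ q′`
  have hwin : Real.log q / 2 + δ ≤ Real.log q' / 2 := by
    have hq'1 : (q : ℝ) + 1 ≤ q' := by exact_mod_cast h.2.2.1
    have h1 : (q : ℝ) * Real.exp (2 * δ) ≤ q' := by
      have : (q : ℝ) * Real.exp (2 * δ) ≤ q * (1 + 1 / q) := mul_le_mul_of_nonneg_left hδq hq0.le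
      have e3 : (q : ℝ) * (1 + 1 / q) = q + 1 := by field_simp
      linarith
    have h2 : Real.log q + 2 * δ ≤ Real.log q' := by
      have h4 : Real.log ((q : ℝ) * Real.exp (2 * δ)) ≤ Real.log q' := Real.log_le_log (by positivity) h1
      rwa [Real.log_mul hq0.ne' (Real.exp_pos _).ne', Real.log_exp] at h4
    linarith
  have hgs : tsupport g ⊆ Icc (-(Real.log q' / 2)) (Real.log q' / 2) := by
    have h1 := tsupport_pair_subset (L := Real.log q) hδ hδL.le (-1)
    have e : (fun x ↦ cramerBump δ (Real.log q / 2) x + (-1) * cramerBump δ (Real.log q / 2) (-x)) = g := by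
      funext x; simp [hg, sub_eq_add_neg]
    rw [e] at h1
    exact h1.trans (Icc_subset_Icc (by linarith) hwin)
  rw [re_weilQuadratic_eq_contribution_sub_deficit h (isWeilTest_oddPair hδ _) hgs, contribution_oddPair hδ hδL]
  unfold deficit
  linarith [re_weilSemilocalQuadratic_oddPair_le h.1 h3 hδ hδq]

/-! ## §4 THE FOOT: gain-to-energy ratio `≥ cap(q)/(log(1/δ) + K_q)` — packaged statements -/

/-- **THE LOGARITHMIC FOOT (RH-free inequality).** For consecutive primes `q < q′` with `q ≥ 3` and `0 < δ`, `e^{2δ} ≤ 1 + 1/q`, the odd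
Cramér pair `g ∈ C((log q)/2 + δ)` has `contribution_q(g) = cap(q)‖g‖₂² > 0` and
`cap(q)·Re Q(g) ≤ (log(1/δ) + cramerEnergyConst + 3 + cap(q))·contribution_q(g)`. Under the window input `0 < ε((log q)/2 + δ)` of
file XII-h this reads `ρ_q((log q)/2 + δ) ≥ cap(q)/(log(1/δ) + cramerEnergyConst + 3 + cap(q))`: the capacity of the new prime does
not vanish to any power order at its entrance (idea-3 G14-3/G14-4; prove-2's `uvFloor_le_bsCapacity` is the sharper kernel form).
[this track: idea-3 PART G14, prove-2 ATTEMPT-14, theory-2 gen6 variant; cite: Bombieri2000Weil, Thm 2 / §4 Lemma 2] -/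
theorem cap_mul_re_weilQuadratic_le (h : ConsecutivePrimes q q') (h3 : 3 ≤ q) (hδ : 0 < δ)
    (hδq : Real.exp (2 * δ) ≤ 1 + 1 / q) :
    Real.log q / Real.sqrt q *
        (weilQuadratic (fun x ↦ cramerBump δ (Real.log q / 2) x - cramerBump δ (Real.log q / 2) (-x))).re ≤
      (Real.log (1 / δ) + cramerEnergyConst + 3 + Real.log q / Real.sqrt q) *
        contribution q (fun x ↦ cramerBump δ (Real.log q / 2) x - cramerBump δ (Real.log q / 2) (-x)) := by
  have hδL : 2 * δ < Real.log q := by linarith [delta_le_sixth h3 hδq, half_lt_log_half h3]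
  have hcap : 0 ≤ Real.log q / Real.sqrt q := (HandoffLoadCeiling.cap_pos (by omega)).le
  rw [contribution_oddPair hδ hδL]
  linarith [mul_le_mul_of_nonneg_left (re_weilQuadratic_oddPair_le h h3 hδ hδq) hcap]

end Summit.RiemannHypothesis.RiemannHypothesis.Theorems.HandoffCapacityFoot

end
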